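import Summits.QuantumAdvantage.QuantumAdvantage.Theorems.ArithStatLadderIqThreeNotPPolyPairTests
import Literature.Computability.Complexity.StackWords
import Literature.Computability.Complexity.CountingProofs
import Literature.Computability.Complexity.LengthCompare

/-!
# The class number `h(−d)` is a `#P` function of the numeral of `d`

Helper file for the crux `ArithStatLadder.IqThreeNotPPoly` (stmt-QuantumAdvantage-2422, `IQ3 ∉ P/poly`,
`IQ3 = bin {d : −d fundamental, 3 ∣ h(−d)}`), line `Sketch`, continuation lead c3. The disprover's
negative lemma `Negative.RefutationShape.PSPACE_not_subset_PPoly_of` (and crux 2424's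
`Negative.RefutationCost.BQP_ne_PSPACE_of_not_iqThreeMemBQP`) take the folklore membership
`IQ3 ∈ PSPACE` as a HYPOTHESIS ("count reduced forms in polynomial space; not constructed in the
tree"). This file (part 2; the brick compiler is part 1,
`ArithStatLadderIqThreeNotPPolyPairTests.lean`) constructs its counting core: **the form class number
`h(D) = #reducedForms D` of `ReducedForms.lean` at `D = −⟦w⟧` is a `#P` function of the string `w`**
(`classNumber_negVal_mem_SharpP`).

Witnesses. For `ℓ = |w| + 1` a witness is a string `y ∈ {0,1}^{3ℓ}` cut into three `ℓ`-bit blocks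
`A T C` (least significant bit first) with values `a = ⟦A⟧`, `t = ⟦T⟧`, `c = ⟦C⟧`; it stands for the
form `(a, t − a, c)` (the middle coefficient `b = t − a ∈ [−a, a]` is shifted to `t ∈ [0, 2a]` so
that everything is natural-number arithmetic). The polynomial-time verifier (a brick assembly,
`exists_redForm_test`) accepts iff

  `0 < a`, `t ≤ 2a`, `a ≤ c`, `t² + a² + d = 4ac + 2at` (i.e. `b² − 4ac = −d`),
  `(t = 0 ∨ t = 2a ∨ a = c) → a ≤ t` (i.e. `b ≥ 0` if `|b| = a` or `a = c`), `gcd(a, t, c) = 1`,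

which is exactly "`(a, t − a, c)` is a reduced primitive positive definite form of discriminant
`−d`" (`mem_reducedForms_iff`; `gcd(a, t − a) = gcd(a, t)`). Since a reduced form of discriminant
`−d` has `a, c ≤ d` and `0 ≤ a + b ≤ 2d < 2^ℓ`, each reduced form has exactly one witness
(`cnt_redForm_eq_card`), so `#witnesses = h(−d)` (`cnt_redForm_eq_classNumber`; at `d = 0` both
sides vanish).

No definition is introduced: the verifier is packaged existentially and the predicate is written
out. Sorry-free; axioms ⊆ {propext, Classical.choice, Quot.sound}.

References: D. A. Cox, *Primes of the form x² + ny²*, 2nd ed., Wiley 2013, §2.A, Thm. 2.13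
(`h(D)` = number of reduced forms; the bounds (2.12)); L. G. Valiant, *The complexity of computing
the permanent*, TCS 8 (1979), §2 (`#P`); S. Arora, B. Barak, *Computational Complexity*, CUP 2009,
Def. 17.2 (`#P` by witness counting).
-/

noncomputable section

set_option linter.dupNamespace false

namespace Summit.QuantumAdvantage.QuantumAdvantage.Theorems.IqThreeNotPPoly

open _root_.Computability Polynomial
open Literature.Computability.Complexity Literature.Computability.Complexity.Brick
open Literature.NumberTheory.QuadraticFields
open Literature.NumberTheory.QuadraticFields.BinaryQuadraticForm
  (discr IsPrimitive IsReduced reducedForms classNumber mem_reducedForms_iff le_of_isReduced discr_apply)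

/-! ### The reduced-form verifier -/

/-- **The reduced-form verifier.** A one-bit `FP` function accepting `⟨w, y⟩` iff, with
`d = ⟦w⟧`, `ℓ = |w| + 1`, `a = ⟦y ↾ ℓ⟧`, `t = ⟦(y ⇂ ℓ) ↾ ℓ⟧`, `c = ⟦(y ⇂ ℓ) ⇂ ℓ⟧`:
`0 < a`, `t ≤ 2a`, `a ≤ c`, `t² + a² + d = 4ac + 2at`, `(t = 0 ∨ t = 2a ∨ a = c) → a ≤ t`,
`gcd (gcd a t) c = 1` — i.e. `(a, t − a, c)` is a reduced primitive positive definite form of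
discriminant `−d`. -/
theorem exists_redForm_test : ∃ V ∈ FP, OneBit V ∧ ∀ w y : List Bool, V (boolPair w y) = [true] ↔
    (0 < bitsToNat (y.take (w.length + 1)) ∧
      bitsToNat ((y.drop (w.length + 1)).take (w.length + 1)) ≤ 2 * bitsToNat (y.take (w.length + 1)) ∧
      bitsToNat (y.take (w.length + 1)) ≤ bitsToNat ((y.drop (w.length + 1)).drop (w.length + 1)) ∧
      bitsToNat ((y.drop (w.length + 1)).take (w.length + 1)) *
            bitsToNat ((y.drop (w.length + 1)).take (w.length + 1)) +
          bitsToNat (y.take (w.length + 1)) * bitsToNat (y.take (w.length + 1)) + bitsToNat w =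
        4 * bitsToNat (y.take (w.length + 1)) * bitsToNat ((y.drop (w.length + 1)).drop (w.length + 1)) +
          2 * bitsToNat (y.take (w.length + 1)) * bitsToNat ((y.drop (w.length + 1)).take (w.length + 1)) ∧
      ((bitsToNat ((y.drop (w.length + 1)).take (w.length + 1)) = 0 ∨
          bitsToNat ((y.drop (w.length + 1)).take (w.length + 1)) = 2 * bitsToNat (y.take (w.length + 1)) ∨
          bitsToNat (y.take (w.length + 1)) = bitsToNat ((y.drop (w.length + 1)).drop (w.length + 1))) →
        bitsToNat (y.take (w.length + 1)) ≤ bitsToNat ((y.drop (w.length + 1)).take (w.length + 1))) ∧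
      Nat.gcd (Nat.gcd (bitsToNat (y.take (w.length + 1)))
          (bitsToNat ((y.drop (w.length + 1)).take (w.length + 1))))
        (bitsToNat ((y.drop (w.length + 1)).drop (w.length + 1))) = 1) := by
  have hA := pairNat_blockA
  have hT := pairNat_blockT
  have hC := pairNat_blockC
  have hD := pairNat_fst
  have h2A := pairNat_mul (pairNat_const 2) hA
  exact pairTest_and (pairTest_lt (pairNat_const 0) hA) (pairTest_and (pairTest_le hT h2A) (pairTest_and (pairTest_le hA hC)
    (pairTest_and (pairTest_eq (pairNat_add (pairNat_add (pairNat_mul hT hT) (pairNat_mul hA hA)) hD)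
      (pairNat_add (pairNat_mul (pairNat_mul (pairNat_const 4) hA) hC) (pairNat_mul h2A hT)))
    (pairTest_and (pairTest_imp (pairTest_or (pairTest_eq hT (pairNat_const 0)) (pairTest_or (pairTest_eq hT h2A) (pairTest_eq hA hC)))
      (pairTest_le hA hT)) (pairTest_eq (pairNat_gcd (pairNat_gcd hA hT) hC) (pairNat_const 1))))))

/-! ### The shifted coordinates `(a, t, c) ↦ (a, t − a, c)` and reduced forms -/

/-- `gcd(a, |t − a|) = gcd(a, t)`. -/
theorem gcd_natAbs_sub (a t : ℕ) : Nat.gcd a (Int.natAbs ((t : ℤ) - a)) = Nat.gcd a t := by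
  rcases le_total a t with h | h
  · rw [show ((t : ℤ) - a) = ((t - a : ℕ) : ℤ) by omega, Int.natAbs_natCast]
    exact Nat.gcd_sub_self_right h
  · rw [show ((t : ℤ) - a) = -((a - t : ℕ) : ℤ) by omega, Int.natAbs_neg, Int.natAbs_natCast]
    exact Nat.gcd_self_sub_right h

/-- A block triple satisfying the verifier's conditions gives a reduced primitive positive
definite form `(a, t − a, c)` of discriminant `−d`. -/
theorem toForm_mem_reducedForms {d a t c : ℕ} (hd : 0 < d)
    (h : 0 < a ∧ t ≤ 2 * a ∧ a ≤ c ∧ t * t + a * a + d = 4 * a * c + 2 * a * t ∧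
      ((t = 0 ∨ t = 2 * a ∨ a = c) → a ≤ t) ∧ Nat.gcd (Nat.gcd a t) c = 1) :
    ((a : ℤ), (t : ℤ) - a, (c : ℤ)) ∈ reducedForms (-(d : ℤ)) := by
  obtain ⟨ha, ht, hac, hdisc, hbd, hg⟩ := h
  rw [mem_reducedForms_iff (by omega)]
  refine ⟨?_, (show (0 : ℤ) < (a : ℤ) by exact_mod_cast ha), ?_, ?_⟩
  · rw [discr_apply]
    have e : ((t * t + a * a + d : ℕ) : ℤ) = ((4 * a * c + 2 * a * t : ℕ) : ℤ) := by rw [hdisc]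
    push_cast at e
    linarith
  · show Int.gcd (Int.gcd (a : ℤ) ((t : ℤ) - a)) (c : ℤ) = 1
    simp only [Int.gcd, Int.natAbs_natCast, gcd_natAbs_sub]
    exact hg
  · refine ⟨(show -(a : ℤ) ≤ (t : ℤ) - a by omega), (show (t : ℤ) - a ≤ a by omega),
      (show (a : ℤ) ≤ c by exact_mod_cast hac), fun hh => ?_⟩
    have hh' : (t : ℤ) - a = -a ∨ (t : ℤ) - a = a ∨ (a : ℤ) = c := hh
    show (0 : ℤ) ≤ (t : ℤ) - a
    have : t = 0 ∨ t = 2 * a ∨ a = c := by omega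
    have := hbd this
    omega

/-- Conversely, a reduced primitive positive definite form `(a', b', c')` of discriminant `−d`,
`d > 0`, has `0 < a' ≤ d`, `0 ≤ a' + b' ≤ 2d`, `0 ≤ c' ≤ d`, and its shifted natural
coordinates `(a', a' + b', c')` satisfy the verifier's conditions. -/
theorem cond_of_mem_reducedForms {d : ℕ} (hd : 0 < d) {a' b' c' : ℤ}
    (hQ : (a', b', c') ∈ reducedForms (-(d : ℤ))) :
    0 < a' ∧ a' ≤ d ∧ 0 ≤ a' + b' ∧ a' + b' ≤ 2 * d ∧ 0 ≤ c' ∧ c' ≤ d ∧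
    (0 < a'.toNat ∧ (a' + b').toNat ≤ 2 * a'.toNat ∧ a'.toNat ≤ c'.toNat ∧
      (a' + b').toNat * (a' + b').toNat + a'.toNat * a'.toNat + d =
        4 * a'.toNat * c'.toNat + 2 * a'.toNat * (a' + b').toNat ∧
      (((a' + b').toNat = 0 ∨ (a' + b').toNat = 2 * a'.toNat ∨ a'.toNat = c'.toNat) →
        a'.toNat ≤ (a' + b').toNat) ∧
      Nat.gcd (Nat.gcd a'.toNat (a' + b').toNat) c'.toNat = 1) := by
  rw [mem_reducedForms_iff (by omega)] at hQ
  obtain ⟨hdisc, ha, hprim, hred⟩ := hQ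
  simp only at ha
  obtain ⟨h3a, hb1, hb2, hac⟩ := le_of_isReduced hdisc ha hred
  obtain ⟨-, -, -, hbd⟩ := hred
  simp only at hbd
  rw [discr_apply] at hdisc
  -- bounds
  have hb2' : b' ^ 2 ≤ a' ^ 2 := by nlinarith
  have hc : 4 * a' * c' = b' ^ 2 + d := by linarith
  have hcle : c' ≤ d := by nlinarith
  have hc0 : 0 ≤ c' := by linarith
  -- natural coordinates
  obtain ⟨a, rfl⟩ : ∃ a : ℕ, a' = a := ⟨a'.toNat, (Int.toNat_of_nonneg ha.le).symm⟩
  obtain ⟨t, ht⟩ : ∃ t : ℕ, a + b' = t := ⟨(a + b').toNat, (Int.toNat_of_nonneg (by linarith)).symm⟩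
  obtain ⟨c, rfl⟩ : ∃ c : ℕ, c' = c := ⟨c'.toNat, (Int.toNat_of_nonneg hc0).symm⟩
  have hb : b' = t - a := by linarith
  subst hb
  simp only [Int.toNat_natCast, ht]
  refine ⟨ha, by linarith, by linarith, by linarith, hc0, hcle, by exact_mod_cast ha, ?_, by exact_mod_cast hac,
    ?_, fun hh => ?_, ?_⟩
  · linarith
  · have e : (((t * t + a * a + d : ℕ) : ℤ)) = ((4 * a * c + 2 * a * t : ℕ) : ℤ) := by
      push_cast; linarith
    exact_mod_cast e
  · have : (t : ℤ) - a = -a ∨ (t : ℤ) - a = a ∨ (a : ℤ) = c := by omega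
    have := hbd this
    omega
  · have hg : Int.gcd (Int.gcd (a : ℤ) ((t : ℤ) - a)) (c : ℤ) = 1 := hprim
    simp only [Int.gcd, Int.natAbs_natCast, gcd_natAbs_sub] at hg
    exact hg

/-! ### Counting: one witness per reduced form -/

/-- **One witness per reduced form.** For `0 < d` with `2d < 2^ℓ`, the strings `y ∈ {0,1}^{3ℓ}`
whose blocks pass the verifier's conditions are in bijection with `reducedForms (−d)`
(`y ↦ (a, t − a, c)`; inverse by `ℓ`-bit words, `natToWord`). -/
theorem cnt_redForm_eq_card (d ℓ : ℕ) (hd : 0 < d) (hdl : 2 * d < 2 ^ ℓ) :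
    cnt (3 * ℓ) {y : List Bool |
      0 < bitsToNat (y.take ℓ) ∧
      bitsToNat ((y.drop ℓ).take ℓ) ≤ 2 * bitsToNat (y.take ℓ) ∧
      bitsToNat (y.take ℓ) ≤ bitsToNat ((y.drop ℓ).drop ℓ) ∧
      bitsToNat ((y.drop ℓ).take ℓ) * bitsToNat ((y.drop ℓ).take ℓ) +
          bitsToNat (y.take ℓ) * bitsToNat (y.take ℓ) + d =
        4 * bitsToNat (y.take ℓ) * bitsToNat ((y.drop ℓ).drop ℓ) +
          2 * bitsToNat (y.take ℓ) * bitsToNat ((y.drop ℓ).take ℓ) ∧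
      ((bitsToNat ((y.drop ℓ).take ℓ) = 0 ∨ bitsToNat ((y.drop ℓ).take ℓ) = 2 * bitsToNat (y.take ℓ) ∨
          bitsToNat (y.take ℓ) = bitsToNat ((y.drop ℓ).drop ℓ)) →
        bitsToNat (y.take ℓ) ≤ bitsToNat ((y.drop ℓ).take ℓ)) ∧
      Nat.gcd (Nat.gcd (bitsToNat (y.take ℓ)) (bitsToNat ((y.drop ℓ).take ℓ)))
        (bitsToNat ((y.drop ℓ).drop ℓ)) = 1} = (reducedForms (-(d : ℤ))).card := by
  classical
  unfold cnt
  refine Finset.card_bij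
    (fun r _ => ((bitsToNat (r.toList.take ℓ) : ℤ),
      (bitsToNat ((r.toList.drop ℓ).take ℓ) : ℤ) - bitsToNat (r.toList.take ℓ),
      (bitsToNat ((r.toList.drop ℓ).drop ℓ) : ℤ)))
    (fun r hr => ?_) (fun r₁ hr₁ r₂ hr₂ h => ?_) (fun Q hQ => ?_)
  · -- into `reducedForms (−d)`
    simp only [Finset.mem_filter, Finset.mem_univ, true_and, Set.mem_setOf_eq] at hr
    exact toForm_mem_reducedForms hd hr
  · -- injective: equal values of equal-length blocks give equal blocks
    simp only [Prod.mk.injEq] at h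
    obtain ⟨h1, h2, h3⟩ := h
    have e1 : (bitsToNat (r₁.toList.take ℓ)) = bitsToNat (r₂.toList.take ℓ) := by exact_mod_cast h1
    have e2 : bitsToNat ((r₁.toList.drop ℓ).take ℓ) = bitsToNat ((r₂.toList.drop ℓ).take ℓ) := by
      have := h2; push_cast [e1] at this; exact_mod_cast (by linarith : (bitsToNat ((r₁.toList.drop ℓ).take ℓ) : ℤ) = bitsToNat ((r₂.toList.drop ℓ).take ℓ))
    have e3 : bitsToNat ((r₁.toList.drop ℓ).drop ℓ) = bitsToNat ((r₂.toList.drop ℓ).drop ℓ) := by exact_mod_cast h3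
    have hl₁ := r₁.toList_length
    have hl₂ := r₂.toList_length
    have b1 : r₁.toList.take ℓ = r₂.toList.take ℓ :=
      bitsToNat_injOn_length ℓ (by simp; omega) (by simp; omega) e1
    have b2 : (r₁.toList.drop ℓ).take ℓ = (r₂.toList.drop ℓ).take ℓ :=
      bitsToNat_injOn_length ℓ (by simp; omega) (by simp; omega) e2
    have b3 : (r₁.toList.drop ℓ).drop ℓ = (r₂.toList.drop ℓ).drop ℓ :=
      bitsToNat_injOn_length ℓ (by simp; omega) (by simp; omega) e3
    apply List.Vector.toList_injective
    rw [← List.take_append_drop ℓ r₁.toList, ← List.take_append_drop ℓ (r₁.toList.drop ℓ),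
      ← List.take_append_drop ℓ r₂.toList, ← List.take_append_drop ℓ (r₂.toList.drop ℓ), b1, b2, b3]
  · -- surjective: the `ℓ`-bit words of `(a', a' + b', c')`
    obtain ⟨a', b', c'⟩ := Q
    obtain ⟨ha, had, ht0, htd, hc0, hcd, hcond⟩ := cond_of_mem_reducedForms hd hQ
    have hal : a'.toNat < 2 ^ ℓ := by
      have : (a'.toNat : ℤ) = a' := Int.toNat_of_nonneg ha.le
      omega
    have htl : (a' + b').toNat < 2 ^ ℓ := by
      have : ((a' + b').toNat : ℤ) = a' + b' := Int.toNat_of_nonneg ht0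
      omega
    have hcl : c'.toNat < 2 ^ ℓ := by
      have : (c'.toNat : ℤ) = c' := Int.toNat_of_nonneg hc0
      omega
    refine ⟨⟨natToWord ℓ a'.toNat ++ (natToWord ℓ (a' + b').toNat ++ natToWord ℓ c'.toNat),
      by simp only [List.length_append, length_natToWord]; ring⟩, ?_, ?_⟩
    · simp only [Finset.mem_filter, Finset.mem_univ, true_and, List.Vector.toList_mk, Set.mem_setOf_eq]
      rw [List.take_left' (length_natToWord _ _), List.drop_left' (length_natToWord _ _),
        List.take_left' (length_natToWord _ _), List.drop_left' (length_natToWord _ _),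
        bitsToNat_natToWord_of_lt hal, bitsToNat_natToWord_of_lt htl, bitsToNat_natToWord_of_lt hcl]
      exact hcond
    · simp only [List.Vector.toList_mk]
      rw [List.take_left' (length_natToWord _ _), List.drop_left' (length_natToWord _ _),
        List.take_left' (length_natToWord _ _), List.drop_left' (length_natToWord _ _),
        bitsToNat_natToWord_of_lt hal, bitsToNat_natToWord_of_lt htl, bitsToNat_natToWord_of_lt hcl,
        Int.toNat_of_nonneg ha.le, Int.toNat_of_nonneg ht0, Int.toNat_of_nonneg hc0]
      simp only [Prod.mk.injEq]
      exact ⟨trivial, by ring, trivial⟩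

/-- `h(0) = 0` (the enumeration of `reducedForms 0` is over `1 ≤ a ≤ 0`). -/
theorem classNumber_zero : classNumber 0 = 0 := by decide

/-- **`#witnesses = h(−d)`**: for every string `w`, with `d = ⟦w⟧` and `ℓ = |w| + 1`, the number
of `y ∈ {0,1}^{3ℓ}` accepted by the reduced-form verifier is `classNumber (−d)` (for `d = 0` no
`y` is accepted: `(t − a)² ≤ a² < 4ac`). -/
theorem cnt_redForm_eq_classNumber (w : List Bool) :
    cnt (3 * (w.length + 1)) {y : List Bool |
      0 < bitsToNat (y.take (w.length + 1)) ∧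
      bitsToNat ((y.drop (w.length + 1)).take (w.length + 1)) ≤ 2 * bitsToNat (y.take (w.length + 1)) ∧
      bitsToNat (y.take (w.length + 1)) ≤ bitsToNat ((y.drop (w.length + 1)).drop (w.length + 1)) ∧
      bitsToNat ((y.drop (w.length + 1)).take (w.length + 1)) *
            bitsToNat ((y.drop (w.length + 1)).take (w.length + 1)) +
          bitsToNat (y.take (w.length + 1)) * bitsToNat (y.take (w.length + 1)) + bitsToNat w =
        4 * bitsToNat (y.take (w.length + 1)) * bitsToNat ((y.drop (w.length + 1)).drop (w.length + 1)) +
          2 * bitsToNat (y.take (w.length + 1)) * bitsToNat ((y.drop (w.length + 1)).take (w.length + 1)) ∧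
      ((bitsToNat ((y.drop (w.length + 1)).take (w.length + 1)) = 0 ∨
          bitsToNat ((y.drop (w.length + 1)).take (w.length + 1)) = 2 * bitsToNat (y.take (w.length + 1)) ∨
          bitsToNat (y.take (w.length + 1)) = bitsToNat ((y.drop (w.length + 1)).drop (w.length + 1))) →
        bitsToNat (y.take (w.length + 1)) ≤ bitsToNat ((y.drop (w.length + 1)).take (w.length + 1))) ∧
      Nat.gcd (Nat.gcd (bitsToNat (y.take (w.length + 1)))
          (bitsToNat ((y.drop (w.length + 1)).take (w.length + 1))))
        (bitsToNat ((y.drop (w.length + 1)).drop (w.length + 1))) = 1} =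
      classNumber (-(bitsToNat w : ℤ)) := by
  classical
  rcases Nat.eq_zero_or_pos (bitsToNat w) with h0 | hpos
  · -- `d = 0`: no witness, and `h(0) = 0`
    rw [h0, Nat.cast_zero, neg_zero, classNumber_zero]
    unfold cnt
    rw [Finset.card_eq_zero, Finset.eq_empty_iff_forall_notMem]
    intro r hr
    simp only [Finset.mem_filter, Finset.mem_univ, true_and, Set.mem_setOf_eq] at hr
    obtain ⟨ha, ht, hac, hdisc, -, -⟩ := hr
    rw [Nat.add_zero] at hdisc
    nlinarith
  · rw [classNumber]
    exact cnt_redForm_eq_card (bitsToNat w) (w.length + 1) hpos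
      (by have := bitsToNat_lt w; rw [pow_succ]; omega)

/-! ### `h(−⟦w⟧) ∈ #P` -/

/-- **The reduced-form relation is in `P` and counts the class number**: there is `R ∈ P` with
`#{y ∈ {0,1}^{3(|w|+1)} | ⟨w, y⟩ ∈ R} = h(−⟦w⟧)` for every string `w`. -/
theorem exists_classNumber_relation : ∃ R ∈ Classes.P, ∀ w : List Bool,
    countWitnesses R (3 * (w.length + 1)) w = classNumber (-(bitsToNat w : ℤ)) := by
  obtain ⟨V, hV, h1, hVal⟩ := exists_redForm_test
  refine ⟨{z | V z = [true]}, mem_P_of_mem_FP hV _ fun z => ⟨id, fun hz => ?_⟩, fun w => ?_⟩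
  · obtain ⟨b, hb⟩ := h1 z
    cases b
    · exact hb
    · exact absurd hb hz
  · rw [PPSharpP.countWitnesses_eq_cnt, ← cnt_redForm_eq_classNumber w]
    exact cnt_congr fun y _ => hVal w y

/-- **The class number is a `#P` function**: `w ↦ h(−⟦w⟧) = #reducedForms (−⟦w⟧)` (the form class
number of `ReducedForms.lean`, `= |Cl(𝒪)|` for the imaginary quadratic order of discriminant `−⟦w⟧`
when that is a discriminant) is in Valiant's `#P`, with witness length `3(|w| + 1)`.
[Cox 2013, Thm. 2.13; Valiant 1979, §2] -/
theorem classNumber_negVal_mem_SharpP :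
    (fun w : List Bool => classNumber (-(bitsToNat w : ℤ))) ∈ SharpP := by
  obtain ⟨R, hR, hcount⟩ := exists_classNumber_relation
  refine ⟨R, hR, 3 * (X + 1), fun w => ?_⟩
  show classNumber (-(bitsToNat w : ℤ)) = _
  rw [← hcount w]
  simp

end Summit.QuantumAdvantage.QuantumAdvantage.Theorems.IqThreeNotPPoly

end
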